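import Summits.ResolutionOfSingularities.ResolutionOfSingularities.Theorems.RadicialJungCleanModelsSufficeGameEndAtlas
import Summits.ResolutionOfSingularities.ResolutionOfSingularities.Theorems.RadicialJungCleanModelsSufficeReductionKN

/-!
# Crux `CleanModelsSuffice` (stmt-ResolutionOfSingularities-15883), line `Sketch` — stub
# `stub_gameEndResolves`: the END STATE of the exceptionalisation game is resolved by Kato (10.4)

Route `ResolutionOfSingularities/RadicialJung`, crux `CleanModelsSuffice`, skeleton v5 of
`Summit.ResolutionOfSingularities.ResolutionOfSingularities.Theses.RadicialJung.CleanModelsSuffice`.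
Let `π : V → V₀` be a proper birational model (`V₀` integral, separated and of finite type over a
field `k` of characteristic `p`; `L/K(V₀)` purely inseparable of degree `p`) carrying a game state
`S` in the END STATE (`S.EndCond`). Then, granted Kato 1994 (10.4)
(`Kato1994_logRegularScheme_hasResolution`, the ONE named fact of the line), the normalisation of
`V₀` in `L` has a resolution.

Proof. Transport `L` to a `K(V)`-algebra along `π^♯ : K(V₀) ≅ K(V)` (as in `…ReductionKN`); the
standing hypotheses `S.EndHyp` hold. The Kato charts of the end state (`…GameEndAtlas`: the Kummer
charts of the toroidal points, built from GLOBAL sections generating the charged exceptional ideal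
sheaves — `…GameEndSections`, log regular by `…GameEndChart`, pairwise compatible by charge
constancy `…GameEndCharge` and exponent proportionality `…GameEndProportional`/`…GameEndOverlap` —
and the trivial chart over the open complement of the closed toroidal locus, where `V^L` is regular)
cover `V^L`, are fs, log regular and compatible; `V^L` is locally Noetherian and quasi-compact, so
`atlasOfCharts` assembles a log-regular Zariski fs atlas, Kato (10.4) resolves `V^L`, and the
resolution descends along the proper birational `V^L → V₀^L`
(`CleanResolves.hasResolution_normalizationIn_of_isBirational`).
-/

noncomputable section

set_option linter.dupNamespace false -- mandated namespace of this single-conjunct summit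

open CategoryTheory AlgebraicGeometry TopologicalSpace IsLocalRing
open Literature.AlgebraicGeometry.Resolution Literature.AlgebraicGeometry.Motives
open Summit.ResolutionOfSingularities.ResolutionOfSingularities.Theorems.Picover

namespace Summit.ResolutionOfSingularities.ResolutionOfSingularities.Theorems.RadicialJung.CleanModelsSuffice

/-- STUB (game, the END STATE is resolved by Kato (10.4)). A game state in the end state (`mOld ≤ 1` everywhere, no
exceptional divisor charged where `mOld = 1`) on the proper birational regular model `π : V → V₀` yields, granted Kato 1994
(10.4), a resolution of the normalisation of `V₀` in `L`: transport `L` to a `K(V)`-algebra along `π^♯`; the Kummer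
charts of the toroidal points (boundary sections = local generators of the charged exceptional ideal sheaves, log regular at
every stalk, pairwise compatible by charge constancy and exponent proportionality along the exceptional divisors) and the
trivial chart over the open regular complement of the toroidal locus form a log-regular Zariski fs atlas on `V^L`
(`atlasOfCharts`); Kato (10.4) resolves `V^L`; descend along the proper birational `V^L → V₀^L`. [folklore] -/
theorem stub_gameEndResolves (hK : Kato1994_logRegularScheme_hasResolution.{0})
    (p : ℕ) (hp : p.Prime) (k : Type) [Field k] [CharP k p]
    (V₀ : Scheme.{0}) [IsIntegral V₀] (f₀ : V₀ ⟶ Spec (.of k)) (L : Type) [Field L]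
    [Algebra V₀.functionField L] [IsSeparated f₀] [LocallyOfFiniteType f₀] [QuasiCompact f₀]
    [IsPurelyInseparable V₀.functionField L] (hdeg : Module.finrank V₀.functionField L = p)
    (V : Scheme.{0}) [IsIntegral V] (π : V ⟶ V₀) [IsDominant π] [IsProper π] (hbir : IsBirational π)
    (S : GameState p V₀ L V π) (hend : S.EndCond) :
    Scheme.HasResolution (normalizationIn V₀ L) := by
  -- `π^♯ : K(V₀) ≅ K(V)` and `L` as a `K(V)`-algebra
  have hbij : Function.Bijective (RatFn.functionFieldMap π) :=
    TowerTransport.bijective_functionFieldMap_of_isIso π hbir.isIso_stalkMap_genericPoint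
  let eK : V₀.functionField ≃+* V.functionField := RingEquiv.ofBijective _ hbij
  have heK : ∀ x, eK x = RatFn.functionFieldMap π x := fun _ => rfl
  letI : Algebra V.functionField L :=
    ((algebraMap V₀.functionField L).comp eK.symm.toRingHom).toAlgebra
  have halg : algebraMap V.functionField L =
      (algebraMap V₀.functionField L).comp eK.symm.toRingHom := rfl
  have hcompat : (algebraMap V.functionField L).comp (RatFn.functionFieldMap π) =
      algebraMap V₀.functionField L := by
    refine RingHom.ext fun x => ?_
    rw [halg, RingHom.comp_apply, RingHom.comp_apply, ← heK]
    exact congrArg (algebraMap V₀.functionField L) (eK.symm_apply_apply x)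
  have halg_apply : ∀ g : V₀.functionField,
      algebraMap V.functionField L (RatFn.functionFieldMap π g) = algebraMap V₀.functionField L g :=
    fun g => congrArg (fun φ : V₀.functionField →+* L => φ g) hcompat
  -- degree `p`, characteristic `p`, Noetherian
  have hdeg' : Module.finrank V.functionField L = p := by
    rw [← hdeg]
    exact Algebra.finrank_eq_of_equiv_equiv eK.symm (RingEquiv.refl L) (by ext x; simp [halg])
  haveI : FiniteDimensional V₀.functionField L :=
    Module.finite_of_finrank_pos (by rw [hdeg]; exact hp.pos)
  haveI : FiniteDimensional V.functionField L :=
    Module.finite_of_finrank_pos (by rw [hdeg']; exact hp.pos)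
  haveI : CharP V.functionField p := TowerTransport.charP_functionField V (π ≫ f₀)
  haveI : IsLocallyNoetherian V := LocallyOfFiniteType.isLocallyNoetherian (π ≫ f₀)
  -- the standing hypotheses of the end state
  let H : S.EndHyp :=
    { prime := hp, charP := inferInstance, finrank := hdeg', compat := halg_apply, surj := hbij.2,
      locallyNoetherian := inferInstance, endCond := hend }
  -- `V^L` is locally Noetherian and quasi-compact
  have hLN : IsLocallyNoetherian (normalizationIn V L) :=
    isLocallyNoetherian_normalizationIn_of_finrank p hp k V (π ≫ f₀) L hdeg'
  haveI : CompactSpace V := QuasiCompact.compactSpace_of_compactSpace (π ≫ f₀)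
  haveI : IsFinite (normalizationInι V L) := isFinite_normalizationInι V L (π ≫ f₀)
  haveI : CompactSpace (normalizationIn V L) :=
    QuasiCompact.compactSpace_of_compactSpace (normalizationInι V L)
  -- the Kato charts of the end state: a log-regular Zariski fs atlas on `V^L`
  obtain ⟨𝒜, h𝒜⟩ := atlasOfCharts (normalizationIn V L) hLN ({v : V // v ∈ S.tor} ⊕ Unit) (S.dom H)
    S.rk (S.mon H) (S.chart H) (S.cover H) (S.fs H) (S.isLogRegularLocal_chart H)
    (S.chart_compatible H)
  -- Kato (10.4) on `V^L`, then descent along `V^L → V₀^L`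
  have hres' : Scheme.HasResolution (normalizationIn V L) := hK _ 𝒜 inferInstance h𝒜
  exact CleanResolves.hasResolution_normalizationIn_of_isBirational V₀ f₀ L V π hbir hcompat hres'

end Summit.ResolutionOfSingularities.ResolutionOfSingularities.Theorems.RadicialJung.CleanModelsSuffice

end
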